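import Literature.Analysis.FluidPDE.ElgindiEllipticWeakExistence
import HarnessLib

/-!
# Graph relations in the energy space: `U₁ = αR∂_RU₀`, `U₂ = ∂_θU₀`, `U₃ = tan θU₀` weakly
([Elgindi2021] §7.1, the energy space of Proposition 7.1)

Topic `Literature/Analysis/FluidPDE`. Proof file (everything proved, no definitions, no named
facts) on the proof path of the named fact
`Literature.Analysis.FluidPDE.Elgindi.ElgindiGhoulMasmoudi2021_stabilityCore`
(`ElgindiStabilityDecomposition.lean`). T. M. Elgindi, Ann. of Math. 194 (2021) =
arXiv:1904.04795, §7.1 Proposition 7.1 ("the unique `L²` solution"; "existence and uniqueness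
follows from the standard `L^p` theory", p. 19 of the held text).

Elements `U = (U₀,U₁,U₂,U₃)` of the energy space `weakSpace α` (closure of the graphs
`Jχ = (Ψ, αR∂_RΨ, ∂_θΨ, tan θΨ)`, `Ψ = cos θχ`) keep the graph relations in the weak sense: for every
`C¹` test function `φ` compactly supported in the open strip,
`⟨U₁, φ⟩ = −α⟨U₀, φ + R∂_Rφ⟩` (`weakSpace_inner_one`), `⟨U₂, φ⟩ = −⟨U₀, ∂_θφ⟩`
(`weakSpace_inner_two`), `⟨U₃, φ⟩ = ⟨U₀, tan θφ⟩` (`weakSpace_inner_three`); proved on graphs by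
integration by parts and extended by continuity.
-/

noncomputable section

open MeasureTheory Set Real Filter Function
open _root_.Topology
open scoped ENNReal InnerProductSpace

namespace Literature.Analysis.FluidPDE

namespace Elgindi

/-! ### Test functions of the open strip -/

section test

variable {φ : ℝ → ℝ → ℝ}

/-- A test function of the open strip vanishes off the strip. [folklore] -/
theorem test_eq_zero_of_not_mem (hφS : ∀ p ∈ tsupport (uncurry φ), p ∈ strip) {p : ℝ × ℝ} (hp : p ∉ strip) : φ p.1 p.2 = 0 := by
  have : p ∉ tsupport (uncurry φ) := fun h => hp (hφS p h)
  have := image_eq_zero_of_notMem_tsupport this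
  exact this

/-- `tan θ·φ` is continuous for a test function of the open strip. [folklore] -/
theorem continuous_tan_mul_test (hφ : ContDiff ℝ 1 (uncurry φ)) (hφS : ∀ p ∈ tsupport (uncurry φ), p ∈ strip) :
    Continuous fun p : ℝ × ℝ => Real.tan p.2 * φ p.1 p.2 := by
  have cφ : Continuous fun p : ℝ × ℝ => φ p.1 p.2 := hφ.continuous
  refine continuous_iff_continuousAt.2 fun p => ?_
  by_cases hp : p ∈ tsupport (uncurry φ)
  · have hθ := (hφS p hp).2
    have hcos : Real.cos p.2 ≠ 0 := (Real.cos_pos_of_mem_Ioo ⟨by linarith [hθ.1, Real.pi_pos], hθ.2⟩).ne'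
    have ht : ContinuousAt (fun p : ℝ × ℝ => Real.tan p.2) p :=
      (Real.continuousAt_tan.2 hcos).comp continuousAt_snd
    exact ht.mul cφ.continuousAt
  · -- `φ ≡ 0` near `p`
    have h0 : (fun q : ℝ × ℝ => Real.tan q.2 * φ q.1 q.2) =ᶠ[𝓝 p] fun _ => 0 := by
      have hopen : IsOpen (tsupport (uncurry φ))ᶜ := (isClosed_tsupport _).isOpen_compl
      filter_upwards [hopen.mem_nhds hp] with q hq
      have := image_eq_zero_of_notMem_tsupport hq
      show Real.tan q.2 * φ q.1 q.2 = 0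
      rw [show φ q.1 q.2 = 0 from this, mul_zero]
    exact (continuousAt_const.congr (f := fun _ => (0:ℝ)) h0.symm)

/-- `tan θ·φ` is compactly supported. [folklore] -/
theorem hasCompactSupport_tan_mul_test (hφs : HasCompactSupport (uncurry φ)) :
    HasCompactSupport fun p : ℝ × ℝ => Real.tan p.2 * φ p.1 p.2 := hφs.mul_left

/-- **Graph relation 1 on graphs**: `∫∫ (αR cos θ∂_Rχ)φ = −α∫∫ cos θχ(φ + R∂_Rφ)`. [folklore] -/
theorem integral_graphFn_one_mul (hφ : ContDiff ℝ 1 (uncurry φ)) (hφs : HasCompactSupport (uncurry φ))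
    (hφS : ∀ p ∈ tsupport (uncurry φ), p ∈ strip) {α : ℝ} {χ : ℝ → ℝ → ℝ} (hχ : ContDiff ℝ 1 (uncurry χ)) :
    ∫ p in strip, graphFn α χ 1 p * φ p.1 p.2 = -α * ∫ p in strip, graphFn α χ 0 p * (φ p.1 p.2 + p.1 * dz φ p.1 p.2) := by
  have cχ : Continuous fun p : ℝ × ℝ => χ p.1 p.2 := hχ.continuous
  have cdzχ : Continuous fun p : ℝ × ℝ => dz χ p.1 p.2 := (contDiff_dz_of_contDiff (n := 0) hχ).continuous
  have cφ : Continuous fun p : ℝ × ℝ => φ p.1 p.2 := hφ.continuous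
  have cdzφ : Continuous fun p : ℝ × ℝ => dz φ p.1 p.2 := (contDiff_dz_of_contDiff (n := 0) hφ).continuous
  have sφ : HasCompactSupport fun p : ℝ × ℝ => φ p.1 p.2 := hφs
  have sdzφ : HasCompactSupport fun p : ℝ × ℝ => dz φ p.1 p.2 := hasCompactSupport_dz hφs
  have iL : Integrable fun p : ℝ × ℝ => graphFn α χ 1 p * φ p.1 p.2 := ((continuous_graphFn hχ 1).mul cφ).integrable_of_hasCompactSupport sφ.mul_left
  have iR : Integrable fun p : ℝ × ℝ => graphFn α χ 0 p * (φ p.1 p.2 + p.1 * dz φ p.1 p.2) :=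
    ((continuous_graphFn hχ 0).mul (by fun_prop)).integrable_of_hasCompactSupport ((sφ.add (sdzφ.mul_left (f := fun p : ℝ × ℝ => p.1))).mul_left)
  rw [integral_strip_eq_integral_Ioo_integral_Ioi iL, integral_strip_eq_integral_Ioo_integral_Ioi iR, ← MeasureTheory.integral_const_mul]
  refine setIntegral_congr_fun measurableSet_Ioo fun θ hθ => ?_
  -- slice in `R`: `u = χ(·,θ)`, `v = φ(·,θ)`; `H = u·R·v`, `H' = u'Rv + u(v + Rv')`
  have hu : ContDiff ℝ 1 fun R => χ R θ := hχ.comp (contDiff_id.prodMk contDiff_const)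
  have hv : ContDiff ℝ 1 fun R => φ R θ := hφ.comp (contDiff_id.prodMk contDiff_const)
  have hdu : Differentiable ℝ fun R => χ R θ := hu.differentiable (by simp)
  have hdv : Differentiable ℝ fun R => φ R θ := hv.differentiable (by simp)
  have hvs : HasCompactSupport fun R => φ R θ :=
    HasCompactSupport.of_support_subset_isCompact (hφs.image continuous_fst) fun R hR => ⟨(R, θ), subset_tsupport _ hR, rfl⟩
  have hv's : HasCompactSupport fun R => dz φ R θ := hvs.deriv
  have e1 : ∀ R, deriv (fun R => χ R θ) R = dz χ R θ := fun R => rfl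
  have e2 : ∀ R, deriv (fun R => φ R θ) R = dz φ R θ := fun R => rfl
  have hH : ∀ R, HasDerivAt (fun R => χ R θ * (R * φ R θ)) (dz χ R θ * (R * φ R θ) + χ R θ * (φ R θ + R * dz φ R θ)) R := by
    intro R
    have h1 : HasDerivAt (fun R => R * φ R θ) (1 * φ R θ + R * dz φ R θ) R := (hasDerivAt_id R).mul (hdv R).hasDerivAt
    have := (hdu R).hasDerivAt.mul h1
    rw [e1] at this
    refine this.congr_deriv ?_; ring
  have cH' : Continuous fun R => dz χ R θ * (R * φ R θ) + χ R θ * (φ R θ + R * dz φ R θ) := by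
    have := cdzχ.comp (Continuous.prodMk_right θ); have := cχ.comp (Continuous.prodMk_right θ)
    have := cφ.comp (Continuous.prodMk_right θ); have := cdzφ.comp (Continuous.prodMk_right θ)
    fun_prop
  have sH : HasCompactSupport fun R => χ R θ * (R * φ R θ) := (hvs.mul_left (f := fun R => R)).mul_left
  have sH' : HasCompactSupport fun R => dz χ R θ * (R * φ R θ) + χ R θ * (φ R θ + R * dz φ R θ) :=
    ((hvs.mul_left (f := fun R => R)).mul_left).add ((hvs.add (hv's.mul_left (f := fun R => R))).mul_left)
  have key : ∫ R, (dz χ R θ * (R * φ R θ) + χ R θ * (φ R θ + R * dz φ R θ)) = 0 := by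
    have h0 : Tendsto (fun R => χ R θ * (R * φ R θ)) (cocompact ℝ) (𝓝 0) := sH.is_zero_at_infty
    have := integral_of_hasDerivAt_of_tendsto hH (cH'.integrable_of_hasCompactSupport sH') (h0.mono_left atBot_le_cocompact)
      (h0.mono_left atTop_le_cocompact)
    rw [sub_zero] at this; exact this
  have i1 : Integrable fun R => dz χ R θ * (R * φ R θ) := by
    have := cdzχ.comp (Continuous.prodMk_right θ); have := cφ.comp (Continuous.prodMk_right θ)
    exact (by fun_prop : Continuous fun R => dz χ R θ * (R * φ R θ)).integrable_of_hasCompactSupport ((hvs.mul_left (f := fun R => R)).mul_left)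
  have i2 : Integrable fun R => χ R θ * (φ R θ + R * dz φ R θ) := by
    have := cχ.comp (Continuous.prodMk_right θ); have := cφ.comp (Continuous.prodMk_right θ); have := cdzφ.comp (Continuous.prodMk_right θ)
    exact (by fun_prop : Continuous fun R => χ R θ * (φ R θ + R * dz φ R θ)).integrable_of_hasCompactSupport
      ((hvs.add (hv's.mul_left (f := fun R => R))).mul_left)
  rw [integral_add i1 i2] at key
  -- pass from `ℝ` to `(0,∞)`: the integrands vanish for `R ≤ 0` (support of `φ` in the strip)
  have hφ0 : ∀ R ≤ (0:ℝ), φ R θ = 0 := fun R hR => test_eq_zero_of_not_mem hφS (p := (R, θ)) fun h => absurd h.1 (not_lt.2 hR)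
  have hdzφ0 : ∀ R < (0:ℝ), dz φ R θ = 0 := fun R hR => by
    show deriv (fun R' => φ R' θ) R = 0
    have h0 : (fun R' => φ R' θ) =ᶠ[𝓝 R] fun _ => 0 := Filter.eventuallyEq_of_mem (Iio_mem_nhds hR) fun x hx => hφ0 x hx.le
    rw [h0.deriv_eq, deriv_const]
  have toIoi : ∀ {g : ℝ → ℝ}, (∀ R < 0, g R = 0) → g 0 = 0 → ∫ R, g R = ∫ R in Ioi 0, g R := fun {g} hg hg0 => by
    rw [← setIntegral_eq_integral_of_forall_compl_eq_zero (s := Ioi (0:ℝ)) fun R hR => ?_]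
    simp only [Set.mem_Ioi, not_lt] at hR
    rcases hR.lt_or_eq with h | h
    · exact hg R h
    · rw [h]; exact hg0
  rw [toIoi (fun R hR => by simp [hφ0 R hR.le]) (by simp [hφ0 0 le_rfl]),
    toIoi (fun R hR => by simp [hφ0 R hR.le, hdzφ0 R hR]) (by simp [hφ0 0 le_rfl])] at key
  -- identify with the graph components
  have eL : ∫ R in Ioi (0:ℝ), graphFn α χ 1 (R, θ) * φ (R, θ).1 (R, θ).2 = α * Real.cos θ * ∫ R in Ioi (0:ℝ), dz χ R θ * (R * φ R θ) := by
    rw [← MeasureTheory.integral_const_mul]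
    refine setIntegral_congr_fun measurableSet_Ioi fun R _ => ?_
    show α * (R * (Real.cos θ * dz χ R θ)) * φ R θ = α * Real.cos θ * (dz χ R θ * (R * φ R θ))
    ring
  have eR : ∫ R in Ioi (0:ℝ), graphFn α χ 0 (R, θ) * (φ (R, θ).1 (R, θ).2 + (R, θ).1 * dz φ (R, θ).1 (R, θ).2) =
      Real.cos θ * ∫ R in Ioi (0:ℝ), χ R θ * (φ R θ + R * dz φ R θ) := by
    rw [← MeasureTheory.integral_const_mul]
    refine setIntegral_congr_fun measurableSet_Ioi fun R _ => ?_
    show Real.cos θ * χ R θ * (φ R θ + R * dz φ R θ) = Real.cos θ * (χ R θ * (φ R θ + R * dz φ R θ))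
    ring
  rw [eL, eR]
  have : (∫ R in Ioi (0:ℝ), dz χ R θ * (R * φ R θ)) = -∫ R in Ioi (0:ℝ), χ R θ * (φ R θ + R * dz φ R θ) := by linarith
  rw [this]; ring

/-- **Graph relation 2 on graphs**: `∫∫ ∂_θΨ·φ = −∫∫ Ψ∂_θφ`, `Ψ = cos θχ`. [folklore] -/
theorem integral_graphFn_two_mul (hφ : ContDiff ℝ 1 (uncurry φ)) (hφs : HasCompactSupport (uncurry φ))
    (hφS : ∀ p ∈ tsupport (uncurry φ), p ∈ strip) {α : ℝ} {χ : ℝ → ℝ → ℝ} (hχ : ContDiff ℝ 1 (uncurry χ)) :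
    ∫ p in strip, graphFn α χ 2 p * φ p.1 p.2 = -∫ p in strip, graphFn α χ 0 p * dθ φ p.1 p.2 := by
  obtain ⟨Ψ, hΨ⟩ : ∃ Ψ : ℝ → ℝ → ℝ, Ψ = fun R θ => Real.cos θ * χ R θ := ⟨_, rfl⟩
  have hΨ1 : ContDiff ℝ 1 (uncurry Ψ) := by rw [hΨ]; exact contDiff_cosProfile hχ
  have cΨ : Continuous fun p : ℝ × ℝ => Ψ p.1 p.2 := hΨ1.continuous
  have cdθΨ : Continuous fun p : ℝ × ℝ => dθ Ψ p.1 p.2 := (contDiff_dθ_of_contDiff (n := 0) hΨ1).continuous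
  have cφ : Continuous fun p : ℝ × ℝ => φ p.1 p.2 := hφ.continuous
  have cdθφ : Continuous fun p : ℝ × ℝ => dθ φ p.1 p.2 := (contDiff_dθ_of_contDiff (n := 0) hφ).continuous
  have sφ : HasCompactSupport fun p : ℝ × ℝ => φ p.1 p.2 := hφs
  have sdθφ : HasCompactSupport fun p : ℝ × ℝ => dθ φ p.1 p.2 := hasCompactSupport_dθ_of hφs
  have g2 : ∀ p : ℝ × ℝ, graphFn α χ 2 p = dθ Ψ p.1 p.2 := fun p => by rw [hΨ, dθ_cosProfile hχ]; rfl
  have g0 : ∀ p : ℝ × ℝ, graphFn α χ 0 p = Ψ p.1 p.2 := fun p => by rw [hΨ]; rfl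
  simp only [g2, g0]
  have iL : Integrable fun p : ℝ × ℝ => dθ Ψ p.1 p.2 * φ p.1 p.2 := (cdθΨ.mul cφ).integrable_of_hasCompactSupport sφ.mul_left
  have iR : Integrable fun p : ℝ × ℝ => Ψ p.1 p.2 * dθ φ p.1 p.2 := (cΨ.mul cdθφ).integrable_of_hasCompactSupport sdθφ.mul_left
  rw [integral_strip_eq_integral_Ioi_integral_Ioo iL, integral_strip_eq_integral_Ioi_integral_Ioo iR, ← MeasureTheory.integral_neg]
  refine setIntegral_congr_fun measurableSet_Ioi fun R hR => ?_
  have hu : ContDiff ℝ 1 fun θ => Ψ R θ := hΨ1.comp (contDiff_const.prodMk contDiff_id)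
  have hv : ContDiff ℝ 1 fun θ => φ R θ := hφ.comp (contDiff_const.prodMk contDiff_id)
  have hdu : Differentiable ℝ fun θ => Ψ R θ := hu.differentiable (by simp)
  have hdv : Differentiable ℝ fun θ => φ R θ := hv.differentiable (by simp)
  have hvs : HasCompactSupport fun θ => φ R θ :=
    HasCompactSupport.of_support_subset_isCompact (hφs.image continuous_snd) fun θ hθ => ⟨(R, θ), subset_tsupport _ hθ, rfl⟩
  have hH : ∀ θ, HasDerivAt (fun θ => Ψ R θ * φ R θ) (dθ Ψ R θ * φ R θ + Ψ R θ * dθ φ R θ) θ := fun θ =>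
    (hdu θ).hasDerivAt.mul (hdv θ).hasDerivAt
  have cH' : Continuous fun θ => dθ Ψ R θ * φ R θ + Ψ R θ * dθ φ R θ := by
    have := cdθΨ.comp (Continuous.prodMk_right R); have := cΨ.comp (Continuous.prodMk_right R)
    have := cφ.comp (Continuous.prodMk_right R); have := cdθφ.comp (Continuous.prodMk_right R)
    fun_prop
  have sH : HasCompactSupport fun θ => Ψ R θ * φ R θ := hvs.mul_left
  have sH' : HasCompactSupport fun θ => dθ Ψ R θ * φ R θ + Ψ R θ * dθ φ R θ := hvs.mul_left.add hvs.deriv.mul_left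
  have key : ∫ θ, (dθ Ψ R θ * φ R θ + Ψ R θ * dθ φ R θ) = 0 := by
    have h0 : Tendsto (fun θ => Ψ R θ * φ R θ) (cocompact ℝ) (𝓝 0) := sH.is_zero_at_infty
    have := integral_of_hasDerivAt_of_tendsto hH (cH'.integrable_of_hasCompactSupport sH') (h0.mono_left atBot_le_cocompact)
      (h0.mono_left atTop_le_cocompact)
    rw [sub_zero] at this; exact this
  have i1 : Integrable fun θ => dθ Ψ R θ * φ R θ := by
    have := cdθΨ.comp (Continuous.prodMk_right R); have := cφ.comp (Continuous.prodMk_right R)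
    exact (by fun_prop : Continuous fun θ => dθ Ψ R θ * φ R θ).integrable_of_hasCompactSupport hvs.mul_left
  have i2 : Integrable fun θ => Ψ R θ * dθ φ R θ := by
    have := cΨ.comp (Continuous.prodMk_right R); have := cdθφ.comp (Continuous.prodMk_right R)
    exact (by fun_prop : Continuous fun θ => Ψ R θ * dθ φ R θ).integrable_of_hasCompactSupport hvs.deriv.mul_left
  rw [integral_add i1 i2] at key
  -- pass from `ℝ` to `(0, π/2)`: `φ(R,·)` and `∂_θφ(R,·)` vanish off the open interval
  have hφ0 : ∀ θ, θ ∉ Ioo 0 (π / 2) → φ R θ = 0 := fun θ hθ => test_eq_zero_of_not_mem hφS (p := (R, θ)) fun h => hθ h.2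
  have hdθφ0 : ∀ θ, θ ∉ Ioo 0 (π / 2) → dθ φ R θ = 0 := fun θ hθ => by
    -- `θ ↦ φ(R,θ)` vanishes on the closed set `(Ioo 0 (π/2))ᶜ`; at such `θ` the derivative is `0`
    -- (it is a minimum/maximum... simpler: the support of the slice is a compact subset of the open interval)
    have hK : tsupport (fun θ => φ R θ) ⊆ Ioo 0 (π / 2) := by
      intro θ' hθ'
      have : (R, θ') ∈ tsupport (uncurry φ) := by
        have hsub := tsupport_comp_subset_preimage (uncurry φ) (f := fun θ => (R, θ)) (continuous_const.prodMk continuous_id) hθ'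
        exact hsub
      exact (hφS _ this).2
    have hn : θ ∉ tsupport (fun θ => φ R θ) := fun h => hθ (hK h)
    have : θ ∉ tsupport (deriv fun θ => φ R θ) := fun h => hn (tsupport_deriv_subset h)
    have := image_eq_zero_of_notMem_tsupport this
    exact this
  have toIoo : ∀ {g : ℝ → ℝ}, (∀ θ, θ ∉ Ioo 0 (π / 2) → g θ = 0) → ∫ θ, g θ = ∫ θ in Ioo 0 (π / 2), g θ := fun {g} hg =>
    (setIntegral_eq_integral_of_forall_compl_eq_zero fun θ hθ => hg θ hθ).symm
  rw [toIoo (fun θ hθ => by simp [hφ0 θ hθ]), toIoo (fun θ hθ => by simp [hdθφ0 θ hθ])] at key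
  simp only []
  linarith

/-- **Graph relation 3 on graphs**: `∫∫ (sin θχ)φ = ∫∫ (cos θχ)(tan θφ)`. [folklore] -/
theorem integral_graphFn_three_mul {α : ℝ} (χ φ : ℝ → ℝ → ℝ) :
    ∫ p in strip, graphFn α χ 3 p * φ p.1 p.2 = ∫ p in strip, graphFn α χ 0 p * (Real.tan p.2 * φ p.1 p.2) := by
  refine setIntegral_congr_fun measurableSet_strip fun p hp => ?_
  have hcos : Real.cos p.2 ≠ 0 := (Real.cos_pos_of_mem_Ioo ⟨by linarith [hp.2.1, Real.pi_pos], hp.2.2⟩).ne'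
  show Real.sin p.2 * χ p.1 p.2 * φ p.1 p.2 = Real.cos p.2 * χ p.1 p.2 * (Real.tan p.2 * φ p.1 p.2)
  rw [Real.tan_eq_sin_div_cos]; field_simp

/-! ### The relations on the energy space -/

/-- `U ↦ ⟨U_k, v⟩` is continuous on `E⁴`. [folklore] -/
theorem continuous_inner_component (k : Fin 4) (v : L2Strip) : Continuous fun U : E4 => ⟪U k, v⟫_ℝ :=
  (PiLp.proj (𝕜 := ℝ) 2 (fun _ : Fin 4 => L2Strip) k).continuous.inner continuous_const

/-- **`⟨U₁, φ⟩ = −α⟨U₀, φ + R∂_Rφ⟩`** on the energy space. [cite: Elgindi2021, §7.1 Proposition 7.1 (p. 19 of arXiv:1904.04795)] -/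
theorem weakSpace_inner_one (hφ : ContDiff ℝ 1 (uncurry φ)) (hφs : HasCompactSupport (uncurry φ))
    (hφS : ∀ p ∈ tsupport (uncurry φ), p ∈ strip) {α : ℝ} {U : E4} (hU : U ∈ weakSpace α) :
    ⟪U 1, toL2 fun p => φ p.1 p.2⟫_ℝ = -α * ⟪U 0, toL2 fun p => φ p.1 p.2 + p.1 * dz φ p.1 p.2⟫_ℝ := by
  have cφ : Continuous fun p : ℝ × ℝ => φ p.1 p.2 := hφ.continuous
  have cdzφ : Continuous fun p : ℝ × ℝ => dz φ p.1 p.2 := (contDiff_dz_of_contDiff (n := 0) hφ).continuous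
  have sφ : HasCompactSupport fun p : ℝ × ℝ => φ p.1 p.2 := hφs
  have m1 : MemLp (fun p : ℝ × ℝ => φ p.1 p.2) 2 stripMeasure := memLp_strip_of_continuous cφ sφ
  have m2 : MemLp (fun p : ℝ × ℝ => φ p.1 p.2 + p.1 * dz φ p.1 p.2) 2 stripMeasure :=
    memLp_strip_of_continuous (by fun_prop) (sφ.add ((hasCompactSupport_dz hφs).mul_left (f := fun p : ℝ × ℝ => p.1)))
  have hcl : IsClosed {U : E4 | ⟪U 1, toL2 fun p => φ p.1 p.2⟫_ℝ = -α * ⟪U 0, toL2 fun p => φ p.1 p.2 + p.1 * dz φ p.1 p.2⟫_ℝ} :=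
    isClosed_eq (continuous_inner_component 1 _) (continuous_const.mul (continuous_inner_component 0 _))
  have hsub : (LinearMap.range (graphL α) : Set E4) ⊆
      {U : E4 | ⟪U 1, toL2 fun p => φ p.1 p.2⟫_ℝ = -α * ⟪U 0, toL2 fun p => φ p.1 p.2 + p.1 * dz φ p.1 p.2⟫_ℝ} := by
    rintro U ⟨χ, rfl⟩
    have h1 : ContDiff ℝ 1 (uncurry (χ : ℝ → ℝ → ℝ)) := χ.2.1 1
    rw [Set.mem_setOf_eq, graphL_apply, graphElt_apply, graphElt_apply, inner_toL2 (memLp_graphFn h1 χ.2.2.1 1) m1,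
      inner_toL2 (memLp_graphFn h1 χ.2.2.1 0) m2]
    exact integral_graphFn_one_mul hφ hφs hφS h1
  have hU' : U ∈ closure ((LinearMap.range (graphL α) : Set E4)) := by
    rw [← Submodule.topologicalClosure_coe]; exact hU
  exact closure_minimal hsub hcl hU'

/-- **`⟨U₂, φ⟩ = −⟨U₀, ∂_θφ⟩`** on the energy space. [cite: Elgindi2021, §7.1 Proposition 7.1 (p. 19 of arXiv:1904.04795)] -/
theorem weakSpace_inner_two (hφ : ContDiff ℝ 1 (uncurry φ)) (hφs : HasCompactSupport (uncurry φ))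
    (hφS : ∀ p ∈ tsupport (uncurry φ), p ∈ strip) {α : ℝ} {U : E4} (hU : U ∈ weakSpace α) :
    ⟪U 2, toL2 fun p => φ p.1 p.2⟫_ℝ = -⟪U 0, toL2 fun p => dθ φ p.1 p.2⟫_ℝ := by
  have cφ : Continuous fun p : ℝ × ℝ => φ p.1 p.2 := hφ.continuous
  have cdθφ : Continuous fun p : ℝ × ℝ => dθ φ p.1 p.2 := (contDiff_dθ_of_contDiff (n := 0) hφ).continuous
  have m1 : MemLp (fun p : ℝ × ℝ => φ p.1 p.2) 2 stripMeasure := memLp_strip_of_continuous cφ hφs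
  have m2 : MemLp (fun p : ℝ × ℝ => dθ φ p.1 p.2) 2 stripMeasure := memLp_strip_of_continuous cdθφ (hasCompactSupport_dθ_of hφs)
  have hcl : IsClosed {U : E4 | ⟪U 2, toL2 fun p => φ p.1 p.2⟫_ℝ = -⟪U 0, toL2 fun p => dθ φ p.1 p.2⟫_ℝ} :=
    isClosed_eq (continuous_inner_component 2 _) (continuous_inner_component 0 _).neg
  have hsub : (LinearMap.range (graphL α) : Set E4) ⊆
      {U : E4 | ⟪U 2, toL2 fun p => φ p.1 p.2⟫_ℝ = -⟪U 0, toL2 fun p => dθ φ p.1 p.2⟫_ℝ} := by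
    rintro U ⟨χ, rfl⟩
    have h1 : ContDiff ℝ 1 (uncurry (χ : ℝ → ℝ → ℝ)) := χ.2.1 1
    rw [Set.mem_setOf_eq, graphL_apply, graphElt_apply, graphElt_apply, inner_toL2 (memLp_graphFn h1 χ.2.2.1 2) m1,
      inner_toL2 (memLp_graphFn h1 χ.2.2.1 0) m2]
    exact integral_graphFn_two_mul hφ hφs hφS h1
  have hU' : U ∈ closure ((LinearMap.range (graphL α) : Set E4)) := by
    rw [← Submodule.topologicalClosure_coe]; exact hU
  exact closure_minimal hsub hcl hU'

/-- **`⟨U₃, φ⟩ = ⟨U₀, tan θφ⟩`** on the energy space. [cite: Elgindi2021, §7.1 Proposition 7.1 (p. 19 of arXiv:1904.04795)] -/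
theorem weakSpace_inner_three (hφ : ContDiff ℝ 1 (uncurry φ)) (hφs : HasCompactSupport (uncurry φ))
    (hφS : ∀ p ∈ tsupport (uncurry φ), p ∈ strip) {α : ℝ} {U : E4} (hU : U ∈ weakSpace α) :
    ⟪U 3, toL2 fun p => φ p.1 p.2⟫_ℝ = ⟪U 0, toL2 fun p => Real.tan p.2 * φ p.1 p.2⟫_ℝ := by
  have cφ : Continuous fun p : ℝ × ℝ => φ p.1 p.2 := hφ.continuous
  have m1 : MemLp (fun p : ℝ × ℝ => φ p.1 p.2) 2 stripMeasure := memLp_strip_of_continuous cφ hφs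
  have m2 : MemLp (fun p : ℝ × ℝ => Real.tan p.2 * φ p.1 p.2) 2 stripMeasure :=
    memLp_strip_of_continuous (continuous_tan_mul_test hφ hφS) (hasCompactSupport_tan_mul_test hφs)
  have hcl : IsClosed {U : E4 | ⟪U 3, toL2 fun p => φ p.1 p.2⟫_ℝ = ⟪U 0, toL2 fun p => Real.tan p.2 * φ p.1 p.2⟫_ℝ} :=
    isClosed_eq (continuous_inner_component 3 _) (continuous_inner_component 0 _)
  have hsub : (LinearMap.range (graphL α) : Set E4) ⊆
      {U : E4 | ⟪U 3, toL2 fun p => φ p.1 p.2⟫_ℝ = ⟪U 0, toL2 fun p => Real.tan p.2 * φ p.1 p.2⟫_ℝ} := by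
    rintro U ⟨χ, rfl⟩
    have h1 : ContDiff ℝ 1 (uncurry (χ : ℝ → ℝ → ℝ)) := χ.2.1 1
    rw [Set.mem_setOf_eq, graphL_apply, graphElt_apply, graphElt_apply, inner_toL2 (memLp_graphFn h1 χ.2.2.1 3) m1,
      inner_toL2 (memLp_graphFn h1 χ.2.2.1 0) m2]
    exact integral_graphFn_three_mul (χ : ℝ → ℝ → ℝ) φ
  have hU' : U ∈ closure ((LinearMap.range (graphL α) : Set E4)) := by
    rw [← Submodule.topologicalClosure_coe]; exact hU
  exact closure_minimal hsub hcl hU'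

end test

end Elgindi

end Literature.Analysis.FluidPDE
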